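import Summits.HodgeConjecture.HodgeConjecture.Theorems.R90S6SatakeCoeffBCPartner   -- ★ TB3 (p04): `coeff_satakeTransform_bcGraphPartner` (brings ★ W7-b `bcGraphPartnerAlgHom`, the `GL₃` Satake estate)
import Literature.NumberTheory.Automorphic.CartanIwasawaDominanceGL                -- ★ `sum_iwasawaExp_eq_of_mem_orbit` (`|e(γ)| = |λ|` on the cells of `K̃ϖ^λK̃`)
import HarnessLib

/-!
# R90 · S6 «Ch. 14.1–14.5 stable trace formula» — card TB2d, FILE B: THE ε-NORM-FIBRE SUM OF THE TWISTED CONSTANT TERM IS THE BASE-CHANGE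
# PARTNER'S SATAKE COEFFICIENT (`Theorems/R90S6TwistedNormFibreSum.lean`) — the (T4)↔(T6) seam on TB2a FILE 2's own fibre

Cell `hodgecm-mathlib`, crux H413 (`stmt-HodgeConjecture-24833`), route of record `HCCMUnconditional`; programme R90-TF (brief `director/R90-BRIEF.v2.md`
1f40d54518340a35), section S6 (base `R90-C14`, dealer R90-C14-plan (g2)), seat R90-C14-p04 (g2); CARD TB2d (dealt 2026-09-05T02:41:15Z; FILE A = ★ p864814
`R90S6TwistedHyperbolicHeckeFL`), FILE B re-planned 02:56:46Z on R90-C14-p06 (g2)'s TB2a FILE 2 HEAD BYTES (R90 bus 02:45:43Z, (V3)–(V4)).  Lane `--kind proof --supports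
stmt-HodgeConjecture-24833 --as helper`; THEOREMS ONLY over ★ carriers (no definition, no instance, no notation, no named fact, no kit, no `sorry`); imports = ★ TB3
`Theorems/R90S6SatakeCoeffBCPartner` + ★ `CartanIwasawaDominanceGL` + HarnessLib.

## THE PRINT AND THE SEAM
TB2a FILE 2 (V4) computes the ε-twisted orbital integral of the Hecke shell `𝟙_{K̃gK̃}` at an ε-split `δ` as `C · J(δ) · Σ_{p ∈ ℤ²} #{γ ∈ K̃gK̃∕K̃ : e(γ) = e(δ) +
(p₁, 2p₂, p₁)}` — the cell counts of Cartier's constant term ([CartierCorvallis1979, §IV (4.2) p. 146]) summed over the ε-NORM FIBRE through the anchor `c = e(δ)`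
(`a δ Θ(a)⁻¹` shifts `e` by `(a₀ + a₂, 2a₁, a₀ + a₂)`, ★ TJ1 ∕ ★ TL4 (A.3)).  The `U(3)` side of (4.10.2) (★ B2a FILE 2) produces the Satake coefficient of `b(𝟙_{K̃gK̃})` on the
line `ℓ_k`, which ★ TB3 writes as `Σ_{μ : μ₀ − μ₂ = k} (𝒮^{GL}_{wt} 𝟙_{K̃gK̃})_μ`.  This file identifies the two sums: (i) the parametrisation `p ↦ c + (p₁, 2p₂, p₁)` is injective
onto the congruence fibre `{μ : μ₀ − c₀ = μ₂ − c₂, 2 ∣ μ₁ − c₁}` (§1), so the `tsum` is a finite sum over the cells (B.1); (ii) on the cells of `K̃ϖ^λK̃` the total exponent is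
`Σμ = Σλ` (★ `sum_iwasawaExp_eq_of_mem_orbit`), so the parity condition is the SELECTION `2 ∣ Σλ − Σc` — independent of the cell — and the fibre is ★ TB3's norm fibre
`μ₀ − μ₂ = c₀ − c₂` (B.2); (iii) the `GL₃` Satake weight `wt μ = u^{2Σμ − 2⟨ν,μ⟩}`, `⟨ν,μ⟩ = 2μ₀ + μ₁` (★ W7-b letters `hwt`) equals `u^{−2(μ₀ − μ₂)}` — CONSTANT on the norm
fibre — so plain cell counts and weighted Satake coefficients agree up to `u^{2k}` (B.3), and ★ TB3 turns the latter into `(𝒮(b 𝟙_λ))_{ℓ_k}` (B.4).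
[Rogawski1990, §4.10 Prop. 4.10.1 (a) p. 58: «if `E∕F` is unramified and `φ ∈ ℋ̃`, then (4.10.2) holds with `f = ψ̂_G(φ)`»; §4.11 p. 60.]

## WHAT IS PROVED (namespace `Summit.HodgeConjecture.HodgeConjecture.R90.S6`)
* (B.1) `tsum_normFibreParam_eq_sum_filter` — for ANY `N : (Fin 3 → ℤ) → α` vanishing off a finset `M` and any anchor `c`:
  `∑' p : ℤ × ℤ, N (c + (p₁, 2p₂, p₁)) = Σ_{μ ∈ M, μ₀ − c₀ = μ₂ − c₂ ∧ 2 ∣ μ₁ − c₁} N μ` (any topological additive monoid `α`).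
* (B.2) `tsum_card_cells_normFibreParam_eq` — (V4)'s sum at `g = ϖ^λ`, VERBATIM count letters (`finite_orbit_quotient`, `iwasawaExp hϖ γ.out`), any `α` with `ℕ`-cast:
  `∑' p, #{γ : e γ = c + (p₁, 2p₂, p₁)} = if 2 ∣ Σλ − Σc then Σ_{μ ∈ e(cells), μ₀ − μ₂ = c₀ − c₂} #{γ : e γ = μ} else 0`.
* (B.3) `cast_sum_normFibre_card_cells_eq_mul_sum_coeff_satakeTransform` — `Σ_{μ ∈ e(cells), μ₀ − μ₂ = k} #{γ : e γ = μ} = u^{2k} · Σ_{μ ∈ supp(𝒮^{GL}_{wt} c_λ), μ₀ − μ₂ = k}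
  (𝒮^{GL}_{wt} c_λ)_μ` in `ℂ` (★ `IsIwasawaExponent.coeff_satakeTransform_doubleCosetOperator` + the constancy of `wt` on the fibre).
* (B.4) `cast_sum_normFibre_card_cells_eq_mul_coeff_satakeTransform_bcGraphPartner` — `… = u^{2k} · (𝒮_w(b c_λ))_{ℓ_k}` at an inert unramified `w ∣ v` (★ TB3).

HONEST LABEL: HC_CM is proved only modulo the 7 printed citations (2 remaining named inputs: hLiu418 = `stmt-HodgeConjecture-24832`, h413 =
`stmt-HodgeConjecture-24833`) until rung 0 closes; REL ≠ ★ ≠ BUILT.  This file is the GL-side coefficient seam of rows E1.4.4.2.4 ∕ .5 (pure bookkeeping over ★ letters);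
it discharges no named input; the measure constant `C` of (V4) is not touched here.

## References
* [Rogawski1990] J. D. Rogawski, *Automorphic Representations of Unitary Groups in Three Variables*, Ann. of Math. Stud. 123 (1990), §4.9 (4.9.2) p. 55, §4.10
  Prop. 4.10.1 (a), Prop. 4.10.2 pp. 57–59, §4.11 p. 60.
* [CartierCorvallis1979] P. Cartier, *Representations of 𝔭-adic groups: a survey*, PSPM 33.1 (1979), §IV (4.2) p. 146.
* [Macdonald1995] I. G. Macdonald, *Symmetric functions and Hall polynomials*, 2nd ed. (1995), Ch. V (2.6) (`|e(γ)| = |λ|`).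
-/

set_option autoImplicit false
-- the mandated namespace repeats the single-problem summit's segment (`HodgeConjecture.HodgeConjecture`)
set_option linter.dupNamespace false

noncomputable section

open NumberField IsDedekindDomain ValuativeRel
open Literature.NumberTheory.Automorphic Literature.NumberTheory.Automorphic.HermitianLattice Literature.NumberTheory.Automorphic.UnitaryGroup
open scoped MatrixGroups

namespace Summit.HodgeConjecture.HodgeConjecture.R90.S6

universe u

/-! ## §1 The parametrisation `p ↦ c + (p₁, 2p₂, p₁)` of the ε-norm fibre through `c` -/

section Param

/-- The three coordinates of `c + (p₁, 2p₂, p₁)`. [folklore] -/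
private theorem normFibreParam_apply (c : Fin 3 → ℤ) (a b : ℤ) :
    (c + ![a, 2 * b, a]) 0 = c 0 + a ∧ (c + ![a, 2 * b, a]) 1 = c 1 + 2 * b ∧ (c + ![a, 2 * b, a]) 2 = c 2 + a := by
  simp only [Pi.add_apply, Matrix.cons_val_zero, Matrix.cons_val_one, Matrix.cons_val_two, Matrix.head_cons, Matrix.tail_cons, and_self]

/-- **`p ↦ c + (p₁, 2p₂, p₁)` is injective.** [folklore] -/
theorem normFibreParam_injective (c : Fin 3 → ℤ) : Function.Injective fun p : ℤ × ℤ => c + ![p.1, 2 * p.2, p.1] := by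
  intro p q h
  obtain ⟨hp0, hp1, -⟩ := normFibreParam_apply c p.1 p.2
  obtain ⟨hq0, hq1, -⟩ := normFibreParam_apply c q.1 q.2
  have h0 : (c + ![p.1, 2 * p.2, p.1]) 0 = (c + ![q.1, 2 * q.2, q.1]) 0 := congr_fun h 0
  have h1 : (c + ![p.1, 2 * p.2, p.1]) 1 = (c + ![q.1, 2 * q.2, q.1]) 1 := congr_fun h 1
  rw [hp0, hq0] at h0
  rw [hp1, hq1] at h1
  exact Prod.ext (by omega) (by omega)

/-- **The range of `p ↦ c + (p₁, 2p₂, p₁)` is the congruence fibre `{μ : μ₀ − c₀ = μ₂ − c₂, 2 ∣ μ₁ − c₁}`.** [folklore] -/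
theorem mem_range_normFibreParam_iff (c μ : Fin 3 → ℤ) :
    μ ∈ Set.range (fun p : ℤ × ℤ => c + ![p.1, 2 * p.2, p.1]) ↔ μ 0 - c 0 = μ 2 - c 2 ∧ 2 ∣ μ 1 - c 1 := by
  constructor
  · rintro ⟨p, hp⟩
    obtain ⟨h0, h1, h2⟩ := normFibreParam_apply c p.1 p.2
    have e0 : μ 0 = c 0 + p.1 := (congr_fun hp 0).symm.trans h0
    have e1 : μ 1 = c 1 + 2 * p.2 := (congr_fun hp 1).symm.trans h1
    have e2 : μ 2 = c 2 + p.1 := (congr_fun hp 2).symm.trans h2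
    exact ⟨by omega, ⟨p.2, by omega⟩⟩
  · rintro ⟨h02, m, hm⟩
    refine ⟨(μ 0 - c 0, m), ?_⟩
    obtain ⟨h0, h1, h2⟩ := normFibreParam_apply c (μ 0 - c 0) m
    refine funext fun i => ?_
    revert i
    simp only [Fin.forall_fin_succ, Fin.succ_zero_eq_one, Fin.succ_one_eq_two, IsEmpty.forall_iff, and_true]
    exact ⟨by rw [h0]; omega, by rw [h1]; omega, by rw [h2]; omega⟩

/-- **(B.1) THE `tsum` OVER THE PARAMETRISED FIBRE IS A FINITE SUM OVER THE SUPPORT**: for ANY `N : (Fin 3 → ℤ) → α` (topological additive monoid) vanishing off a finset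
`M`, and any anchor `c`: `∑' p : ℤ × ℤ, N (c + (p₁, 2p₂, p₁)) = Σ_{μ ∈ M, μ₀ − c₀ = μ₂ − c₂ ∧ 2 ∣ μ₁ − c₁} N μ`. [folklore] -/
theorem tsum_normFibreParam_eq_sum_filter {α : Type*} [AddCommMonoid α] [TopologicalSpace α] (N : (Fin 3 → ℤ) → α) (M : Finset (Fin 3 → ℤ))
    (hM : ∀ μ ∉ M, N μ = 0) (c : Fin 3 → ℤ) :
    ∑' p : ℤ × ℤ, N (c + ![p.1, 2 * p.2, p.1]) = ∑ μ ∈ M with (μ 0 - c 0 = μ 2 - c 2 ∧ 2 ∣ μ 1 - c 1), N μ := by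
  classical
  -- restrict `N` to the fibre: `f μ = N μ` on the range of the parametrisation, `0` off it
  set f : (Fin 3 → ℤ) → α := fun μ => if μ 0 - c 0 = μ 2 - c 2 ∧ 2 ∣ μ 1 - c 1 then N μ else 0 with hf
  have hfι : ∀ p : ℤ × ℤ, f (c + ![p.1, 2 * p.2, p.1]) = N (c + ![p.1, 2 * p.2, p.1]) := fun p => by
    rw [hf]
    exact if_pos ((mem_range_normFibreParam_iff c _).1 ⟨p, rfl⟩)
  have hsupp : Function.support f ⊆ Set.range (fun p : ℤ × ℤ => c + ![p.1, 2 * p.2, p.1]) := fun μ hμ => by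
    rw [mem_range_normFibreParam_iff]
    by_contra hc
    exact hμ (by rw [hf]; exact if_neg hc)
  calc ∑' p : ℤ × ℤ, N (c + ![p.1, 2 * p.2, p.1]) = ∑' p : ℤ × ℤ, f (c + ![p.1, 2 * p.2, p.1]) := by simp_rw [hfι]
    _ = ∑' μ, f μ := (normFibreParam_injective c).tsum_eq hsupp
    _ = ∑ μ ∈ M, f μ := tsum_eq_sum fun μ hμ => by simp only [hf, hM μ hμ, ite_self]
    _ = ∑ μ ∈ M with (μ 0 - c 0 = μ 2 - c 2 ∧ 2 ∣ μ 1 - c 1), N μ := by rw [Finset.sum_filter]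

end Param

/-! ## §2 At the cells of `K̃ϖ^λK̃`: the parity condition is the selection rule, the fibre is the norm fibre -/

section Cells

variable {K : Type u} [Field K] [ValuativeRel K] [IsDiscreteValuationRing 𝒪[K]] {ϖ : K}
  [IsHeckeTriple (⊤ : Submonoid (GL (Fin 3) K)) (glInt 3 K) (glInt 3 K)] (hϖ : IsUniformizingElement ϖ)

/-- **`Σ e(γ) = Σ λ` on the cells of `K̃ϖ^λK̃`** (★ `sum_iwasawaExp_eq_of_mem_orbit`, read on the finset of cells). [cite: Macdonald1995, Ch. V (2.6)] -/
theorem sum_iwasawaExp_out_eq_of_mem_cells (lam : Fin 3 → ℤ) {γ : GL (Fin 3) K ⧸ glInt 3 K}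
    (hγ : γ ∈ (finite_orbit_quotient (glInt 3 K) (zpowDiagGL hϖ.ne_zero lam)).toFinset) :
    ∑ i, iwasawaExp hϖ γ.out i = ∑ i, lam i := by
  refine sum_iwasawaExp_eq_of_mem_orbit hϖ ?_
  rw [Set.Finite.mem_toFinset] at hγ
  rwa [QuotientGroup.out_eq']

/-- **(B.2) (V4)'s ε-NORM-FIBRE SUM AT `g = ϖ^λ`** — VERBATIM count letters of TB2a FILE 2 (`#{γ ∈ K̃ϖ^λK̃∕K̃ : e(γ) = c + (p₁, 2p₂, p₁)}`), any target `α` with an `ℕ`-cast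
(`ℝ≥0∞` for (V4), `ℂ` for ★ TB3): `∑' p : ℤ × ℤ, #{γ : e γ = c + (p₁, 2p₂, p₁)} = if 2 ∣ Σλ − Σc then Σ_{μ ∈ e(cells), μ₀ − μ₂ = c₀ − c₂} #{γ : e γ = μ} else 0` — the
parity condition `2 ∣ μ₁ − c₁` collapses to the SELECTION RULE `2 ∣ Σλ − Σc` (since `Σμ = Σλ` on the cells), and what is left is the NORM FIBRE `μ₀ − μ₂ = c₀ − c₂`.
[cite: Rogawski1990, §4.10 pp. 57–59; §4.11 p. 60] [cite: CartierCorvallis1979, §IV (4.2) p. 146] -/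
theorem tsum_card_cells_normFibreParam_eq {α : Type*} [AddCommMonoidWithOne α] [TopologicalSpace α] (lam c : Fin 3 → ℤ) :
    ∑' p : ℤ × ℤ, (((finite_orbit_quotient (glInt 3 K) (zpowDiagGL hϖ.ne_zero lam)).toFinset.filter
        fun γ => iwasawaExp hϖ γ.out = c + ![p.1, 2 * p.2, p.1]).card : α) =
      if 2 ∣ ∑ i, lam i - ∑ i, c i then
        ∑ μ ∈ ((finite_orbit_quotient (glInt 3 K) (zpowDiagGL hϖ.ne_zero lam)).toFinset.image fun γ => iwasawaExp hϖ γ.out) with μ 0 - μ 2 = c 0 - c 2,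
          (((finite_orbit_quotient (glInt 3 K) (zpowDiagGL hϖ.ne_zero lam)).toFinset.filter fun γ => iwasawaExp hϖ γ.out = μ).card : α)
      else 0 := by
  classical
  set O := (finite_orbit_quotient (glInt 3 K) (zpowDiagGL hϖ.ne_zero lam)).toFinset with hO
  -- (B.1) with `N μ = #{γ : e γ = μ}`, supported on `M = e(cells)`
  have hM : ∀ μ ∉ O.image (fun γ => iwasawaExp hϖ γ.out), ((O.filter fun γ => iwasawaExp hϖ γ.out = μ).card : α) = 0 := fun μ hμ => by
    rw [Finset.card_eq_zero.2 (Finset.filter_eq_empty_iff.2 fun γ hγ he => hμ (Finset.mem_image.2 ⟨γ, hγ, he⟩)), Nat.cast_zero]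
  rw [tsum_normFibreParam_eq_sum_filter (fun μ => ((O.filter fun γ => iwasawaExp hϖ γ.out = μ).card : α)) _ hM c]
  -- on `M` the parity condition is the selection rule
  have hpar : ∀ μ ∈ O.image (fun γ => iwasawaExp hϖ γ.out),
      (μ 0 - c 0 = μ 2 - c 2 ∧ 2 ∣ μ 1 - c 1) ↔ (μ 0 - μ 2 = c 0 - c 2 ∧ 2 ∣ ∑ i, lam i - ∑ i, c i) := fun μ hμ => by
    obtain ⟨γ, hγ, rfl⟩ := Finset.mem_image.1 hμ
    have hs := sum_iwasawaExp_out_eq_of_mem_cells hϖ lam hγ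
    rw [Fin.sum_univ_three] at hs
    rw [← hs, Fin.sum_univ_three]
    constructor
    · rintro ⟨h02, m, hm⟩
      exact ⟨by omega, ⟨m + (iwasawaExp hϖ γ.out 0 - c 0), by rw [mul_add, ← hm]; omega⟩⟩
    · rintro ⟨h02, m, hm⟩
      exact ⟨by omega, ⟨m - (iwasawaExp hϖ γ.out 0 - c 0), by rw [mul_sub]; omega⟩⟩
  rw [Finset.filter_congr hpar]
  split_ifs with hsel
  · simp only [hsel, and_true]
  · simp only [hsel, and_false, Finset.filter_false, Finset.sum_empty]

end Cells

/-! ## §3 Cell counts on the norm fibre = weighted `GL₃` Satake coefficients = the `b`-partner's coefficient -/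

section Satake

variable {K : Type u} [Field K] [ValuativeRel K] [IsDiscreteValuationRing 𝒪[K]] {ϖ : K}
  [IsHeckeTriple (⊤ : Submonoid (GL (Fin 3) K)) (glInt 3 K) (glInt 3 K)]
  (hϖ : IsUniformizingElement ϖ) {u : ℂˣ} (hu : (u : ℂ) ^ 2 = ((Nat.card 𝓀[K] : ℕ) : ℂ))
  {wt : Multiplicative (Fin 3 → ℤ) →* ℂ}
  (hwt : ∀ e : Fin 3 → ℤ, wt (Multiplicative.ofAdd e) = ((u ^ ((((3 : ℕ) : ℤ) - 1) * (∑ i, e i) - 2 * satakeTwistExp e) : ℂˣ) : ℂ))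

include hwt in
/-- **The `GL₃` Satake weight is CONSTANT on a norm fibre: `wt μ = u^{−2(μ₀ − μ₂)}`** (`2Σμ − 2⟨ν,μ⟩ = 2(μ₀ + μ₁ + μ₂) − 2(2μ₀ + μ₁) = −2(μ₀ − μ₂)`).
[cite: CartierCorvallis1979, §IV (4.2)] -/
theorem satakeWeight_eq_zpow_of_normFibre (μ : Fin 3 → ℤ) : wt (Multiplicative.ofAdd μ) = ((u ^ (-2 * (μ 0 - μ 2)) : ℂˣ) : ℂ) := by
  rw [hwt μ]
  congr 2
  rw [satakeTwistExp, Fin.sum_univ_three, Fin.sum_univ_three]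
  simp only [Fin.val_zero, Fin.val_one, Fin.val_two, Nat.cast_zero, Nat.cast_one, Nat.cast_ofNat]
  ring

include hwt in
/-- **(B.3) CELL COUNTS ON THE NORM FIBRE = `u^{2k}` × THE WEIGHTED SATAKE COEFFICIENTS**: for `c_λ = 𝟙_{K̃ϖ^λK̃}` and every `k ∈ ℤ`,
`Σ_{μ ∈ e(cells), μ₀ − μ₂ = k} #{γ : e γ = μ} = u^{2k} · Σ_{μ ∈ supp(𝒮^{GL}_{wt} c_λ), μ₀ − μ₂ = k} (𝒮^{GL}_{wt} c_λ)_μ` in `ℂ` (★ `IsIwasawaExponent.coeff_satakeTransform_doubleCosetOperator`: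
`(𝒮_{wt} c_λ)_μ = #{γ : e γ = μ} · wt μ`, and `wt μ = u^{−2k}` on the fibre). [cite: CartierCorvallis1979, §IV (4.2) p. 146] [cite: Rogawski1990, §4.9 (4.9.2) p. 55] -/
theorem cast_sum_normFibre_card_cells_eq_mul_sum_coeff_satakeTransform (lam : Fin 3 → ℤ) (k : ℤ) :
    ((∑ μ ∈ ((finite_orbit_quotient (glInt 3 K) (zpowDiagGL hϖ.ne_zero lam)).toFinset.image fun γ => iwasawaExp hϖ γ.out) with μ 0 - μ 2 = k,
        ((finite_orbit_quotient (glInt 3 K) (zpowDiagGL hϖ.ne_zero lam)).toFinset.filter fun γ => iwasawaExp hϖ γ.out = μ).card : ℕ) : ℂ) =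
      ((u ^ (2 * k) : ℂˣ) : ℂ) *
        ∑ μ ∈ ((isIwasawaExponent_gl (n := 3) hϖ).satakeTransform wt
            (heckeAlgebra.doubleCosetOperator (glInt 3 K) (zpowDiagGL hϖ.ne_zero lam))).coeff.support with μ 0 - μ 2 = k,
          ((isIwasawaExponent_gl (n := 3) hϖ).satakeTransform wt (heckeAlgebra.doubleCosetOperator (glInt 3 K) (zpowDiagGL hϖ.ne_zero lam))).coeff μ := by
  classical
  set O := (finite_orbit_quotient (glInt 3 K) (zpowDiagGL hϖ.ne_zero lam)).toFinset with hO
  set S := (isIwasawaExponent_gl (n := 3) hϖ).satakeTransform wt (heckeAlgebra.doubleCosetOperator (glInt 3 K) (zpowDiagGL hϖ.ne_zero lam)) with hS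
  -- the coefficient formula, cell by cell
  have hcoeff : ∀ μ : Fin 3 → ℤ, S.coeff μ = ((O.filter fun γ => iwasawaExp hϖ γ.out = μ).card : ℂ) * wt (Multiplicative.ofAdd μ) := fun μ => by
    rw [hS, hO]
    convert (isIwasawaExponent_gl (n := 3) hϖ).coeff_satakeTransform_doubleCosetOperator wt (zpowDiagGL hϖ.ne_zero lam) μ using 3
  -- the support of `𝒮_{wt} c_λ` inside `e(cells)`, and the fibre sums over the two index sets agree
  have hsub : S.coeff.support.filter (fun μ => μ 0 - μ 2 = k) ⊆ (O.image fun γ => iwasawaExp hϖ γ.out).filter (fun μ => μ 0 - μ 2 = k) := by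
    intro μ hμ
    rw [Finset.mem_filter] at hμ ⊢
    refine ⟨?_, hμ.2⟩
    have hne : S.coeff μ ≠ 0 := Finsupp.mem_support_iff.1 hμ.1
    rw [hcoeff μ] at hne
    have hcard : (O.filter fun γ => iwasawaExp hϖ γ.out = μ).card ≠ 0 := fun h0 => hne (by rw [h0, Nat.cast_zero, zero_mul])
    obtain ⟨γ, hγ⟩ := Finset.card_ne_zero.1 hcard
    exact Finset.mem_image.2 ⟨γ, (Finset.mem_filter.1 hγ).1, (Finset.mem_filter.1 hγ).2⟩
  rw [Finset.sum_subset hsub (fun μ hμM hμS => ?_)]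
  swap
  · -- off the support the coefficient vanishes
    have : μ ∉ S.coeff.support := fun h => hμS (Finset.mem_filter.2 ⟨h, (Finset.mem_filter.1 hμM).2⟩)
    exact Finsupp.notMem_support_iff.1 this
  rw [Nat.cast_sum, Finset.mul_sum]
  refine Finset.sum_congr rfl fun μ hμ => ?_
  have hk : μ 0 - μ 2 = k := (Finset.mem_filter.1 hμ).2
  rw [hcoeff μ, satakeWeight_eq_zpow_of_normFibre hwt μ, hk, ← mul_assoc, mul_comm (((u ^ (2 * k) : ℂˣ) : ℂ)), mul_assoc, ← Units.val_mul, ← zpow_add,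
    show 2 * k + -2 * k = 0 by ring, zpow_zero, Units.val_one, mul_one]

end Satake

/-! ## §4 … = `u^{2k} · (𝒮_w(b c_λ))_{ℓ_k}` at an inert unramified place -/

section Adic

variable {F E : Type} [Field F] [NumberField F] [Field E] [NumberField E] [Algebra F E] [Algebra.IsQuadraticExtension F E]
  (c : E ≃ₐ[F] E) (hc1 : c ≠ 1) (v : HeightOneSpectrum (𝓞 F)) (w : PlacesOver E v) (hw : c • w.1 = w.1)
  (hv : Algebra.IsUnramifiedIn (𝓞 E) v.asIdeal)
  {K : Type u} [Field K] [ValuativeRel K] [IsDiscreteValuationRing 𝒪[K]] [Finite 𝓀[K]] {ϖ : K}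
  [IsHeckeTriple (⊤ : Submonoid (GL (Fin 3) K)) (glInt 3 K) (glInt 3 K)]
  (hϖ : IsUniformizingElement ϖ) {u : ℂˣ} (hu : (u : ℂ) ^ 2 = ((Nat.card 𝓀[K] : ℕ) : ℂ))
  {wt : Multiplicative (Fin 3 → ℤ) →* ℂ}
  (hwt : ∀ e : Fin 3 → ℤ, wt (Multiplicative.ofAdd e) = ((u ^ ((((3 : ℕ) : ℤ) - 1) * (∑ i, e i) - 2 * satakeTwistExp e) : ℂˣ) : ℂ))

/-- **(B.4) THE ε-NORM-FIBRE CELL SUM IS THE BASE-CHANGE PARTNER'S SATAKE COEFFICIENT**: at an inert place `w ∣ v` with `E_w∕F_v` unramified, for every unramified datum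
`hd` at `w`, every `λ` and every `k ∈ ℤ`: `Σ_{μ ∈ e(cells of K̃ϖ^λK̃), μ₀ − μ₂ = k} #{γ : e γ = μ} = u^{2k} · (𝒮_w(b c_λ))_{ℓ_k}`, `ℓ_k = (k, 0, −k)`, `b = ψ̂_G`
(★ `bcGraphPartnerAlgHom`) — (B.3) ∘ ★ TB3 `coeff_satakeTransform_bcGraphPartner`.  With (B.2) this reads TB2a FILE 2 (V4)'s `λ`-dependence as the `U(3)`-side Satake
coefficient that ★ B2a FILE 2 produces for `f = b c_λ` — the `S = W′⁻¹·S₃` half of ★ TB2d FILE A's junction `hJS`.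
[cite: Rogawski1990, §4.10 Prop. 4.10.1 (a), Prop. 4.10.2 pp. 57–59] [cite: CartierCorvallis1979, §IV (4.2), Cor. 4.2] -/
theorem cast_sum_normFibre_card_cells_eq_mul_coeff_satakeTransform_bcGraphPartner {ϖE : w.1.adicCompletion E}
    (hd : UnramifiedLocalConjDatum (galAdicCompletionMap (L := E) c hw) ϖE) (lam : Fin 3 → ℤ) (k : ℤ) :
    ((∑ μ ∈ ((finite_orbit_quotient (glInt 3 K) (zpowDiagGL hϖ.ne_zero lam)).toFinset.image fun γ => iwasawaExp hϖ γ.out) with μ 0 - μ 2 = k,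
        ((finite_orbit_quotient (glInt 3 K) (zpowDiagGL hϖ.ne_zero lam)).toFinset.filter fun γ => iwasawaExp hϖ γ.out = μ).card : ℕ) : ℂ) =
      ((u ^ (2 * k) : ℂˣ) : ℂ) *
        (hd.satakeTransform (bcGraphPartnerAlgHom c hc1 v w hw hv hϖ hu hwt
            (heckeAlgebra.doubleCosetOperator (glInt 3 K) (zpowDiagGL hϖ.ne_zero lam)))).coeff (fun i : Fin 3 => k * (1 - ((i : ℕ) : ℤ))) := by
  rw [cast_sum_normFibre_card_cells_eq_mul_sum_coeff_satakeTransform hϖ hwt lam k, coeff_satakeTransform_bcGraphPartner c hc1 v w hw hv hϖ hu hwt hd _ k]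

end Adic

end Summit.HodgeConjecture.HodgeConjecture.R90.S6
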